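import Summits.Ventures.Crystal3D.Theorems.StickyWulffConstantTextureLiminfTexShadowLevelReachBornBarlow
import Summits.Ventures.Crystal3D.Theorems.StickyWulffConstantTextureLiminfTexShadowLevelReachHexagonPooled
import HarnessLib

/-!
# The FALLING born census of a lamella family below the top plate (the cell mirror of …LevelReachBornBarlow, original coordinates)
# (lane T, crux `TextureLiminfV5`, stmt-Ventures-23912, registered stub `stub_terraceCensus`; (β) assembly RESUME (d) — cf-p1 (cccxii) GO)

HONEST FRAMING. Venture `Summits/Ventures/Crystal3D` (cell `crystal3d-full`), route `route-Ventures-StickyWulffConstant`, helper `--supports` the law-v5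
crux `TextureLiminfV5` (stmt-Ventures-23912), lane T, mechanism (β).  Census-free, certificate-free; `KissingGap δ`, `KissingClassification δ` BY NAME;
nothing about energies; F-C1 not moved.

THE POINT.  `born_barlow_endPairs` (…LevelReachBornBarlow) in the MIRRORED cell `M(X)`, `M p = bM p + h·e₃` (lane F's …OneFccMirrorCell: plates swapped,
heights `p₂ ↦ h − p₂`), for the launch frame `A ≫ bM` and the same root slot `w`, pulled back to the original coordinates with lane F's transport lemmas
(`isFull_transport_iff`, `isTwinReading_mirror_iff`, `isNarrow_transport_iff`, `isMoving_transport_iff`, `isEndMove_transport`; `(A ≫ bM) ≫ bM = A`):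
**`born_barlow_endPairs_top`** — for a launch frame `A` whose dozen is neither of the BOTTOM plate's two dozens and a root slot `w` with `A w` FALLING, the
born launches (FULL in `A`, predecessor `p − A w ∈ X` present and not a trackable straight mover) whose first step lands in the window number at most
`#T + #CUT + 220·(#rim_bot + #rim_top)` (mirrored rims), `T` with the pair / two-payer clauses and the ROOT-CLASS END MOVE in the frame `A` along `A w` —
the falling twin of the rising born family, disjoint from it and from both plate families by the sign of `(bq.1 − bq.2)₂ = (A w)₂ < 0` and by direction.
WHAT THIS IS NOT: born SUPPLY, the pooling, any certificate; F-C1 not moved.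
-/

noncomputable section

namespace Summit.Ventures.Crystal3D.Theorems

open Summit.Ventures.Crystal3D Finset
open Literature.MathematicalPhysics.StatisticalMechanics (barlowPos barlowStacking IsHaggSeq barlowPos_mem basalMirror
  basalMirror_apply_coord basalMirror_basalMirror)
open Summit.Ventures.Crystal3D.Cruxes.TextureLiminf.TexShadow (E3 stacking)
open scoped InnerProductSpace

set_option maxHeartbeats 400000 in
open scoped Classical in
/-- **The falling born census below the top plate, original coordinates.**  Cell data as in `hexagon_barlow_endPairs_cuts_shape`; launch frame `A` with
`A`-dozen neither the BOTTOM plate's dozen nor its basal twin's; root slot `w` with `A w` falling; born launch set `B` as in `born_barlow_endPairs`. -/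
theorem born_barlow_endPairs_top (ver : WordVersion) {δ : ℝ} (hg : KissingGap δ) (hc : KissingClassification δ)
    {σ₁ σ₂ : ℤ → ℤ} (hσ₁ : IsHaggSeq σ₁) (L₁ L₂ : E3 ≃ₗᵢ[ℝ] E3) (s₁ s₂ : E3)
    (A : E3 ≃ₗᵢ[ℝ] E3)
    (hneA₁ : (A : E3 → E3) '' ↑fccSlots ≠ (L₁ : E3 → E3) '' ↑fccSlots)
    (hneA₂ : (A : E3 → E3) '' ↑fccSlots ≠ ((basalMirror.trans L₁ : E3 ≃ₗᵢ[ℝ] E3) : E3 → E3) '' ↑fccSlots)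
    {w : E3} (hw : w ∈ fccSlots) (hdown : (A w) 2 < 0)
    (X P₁ P₂ : Finset E3) (R₀ h ρ : ℝ) (hR₀ : 5 ≤ R₀) (hρ : R₀ + 2 ≤ ρ)
    (hX : ∀ p ∈ X, ∀ q ∈ X, p ≠ q → 1 ≤ dist p q) (hP₁X : P₁ ⊆ X) (hP₂X : P₂ ⊆ X)
    (hP₁ : ∀ p, p ∈ P₁ ↔ (p ∈ stacking L₁ s₁ σ₁ ∧ -(2 * R₀) ≤ p 2 ∧ p 2 ≤ -R₀ ∧ p 0 ^ 2 + p 1 ^ 2 ≤ ρ ^ 2))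
    (hP₂ : ∀ p, p ∈ P₂ ↔ (p ∈ stacking L₂ s₂ σ₂ ∧ h + R₀ ≤ p 2 ∧ p 2 ≤ h + 2 * R₀ ∧ p 0 ^ 2 + p 1 ^ 2 ≤ ρ ^ 2))
    (B : Finset E3)
    (hborn : ∀ p ∈ B, p ∈ X ∧ IsFull X A p ∧ p - A w ∈ X ∧
      ¬ (p - A w - A w ∈ X ∧
        (IsFull X A (p - A w) ∨ (∃ m, IsTwinReading X A m (p - A w) ∧ ⟪A w, m⟫_ℝ = 0) ∨
          (ver = WordVersion.v2 ∧ IsNarrow X A (A w) (p - A w))))) :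
    ∃ T : Finset (E3 × E3),
      (B.filter fun p => -(R₀ + 1) - 1 < (p + A w) 2 ∧ (p + A w) 2 < h + (R₀ + 1) + 1).card ≤
        T.card +
        (X.filter fun b => -(R₀ + 1) - 1 < b 2 ∧ b 2 ≤ h + (R₀ + 1) + 1 ∧
            (∃ μ, ⟪w, μ⟫_ℝ = Real.sqrt (2 / 3) ∧ IsTwinReading X A (A μ) b) ∧ b - A w ∈ X).card +
        220 * (X.filter fun s => -(R₀ + 1) - 1 - 1 ≤ s 2 ∧ s 2 ≤ -(R₀ + 1) - 1 ∧
            (ρ - 1 - 2) ^ 2 < s 0 ^ 2 + s 1 ^ 2).card +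
        220 * (X.filter fun s => h + (R₀ + 1) + 1 < s 2 ∧ s 2 ≤ h + (R₀ + 1) + 1 + 1 ∧
            (ρ - 1 - 1) ^ 2 < s 0 ^ 2 + s 1 ^ 2).card ∧
      (∀ bq ∈ T, bq.1 ∈ X ∧ bq.2 ∈ X ∧ dist bq.1 bq.2 = 1 ∧ -(R₀ + 1) - 1 < bq.1 2 ∧ bq.1 2 ≤ h + (R₀ + 1) + 1) ∧
      (∀ bq ∈ T, (X.filter fun q => dist bq.1 q = 1).card ≤ 11 ∨
        ∃ z₁ ∈ X, ∃ z₂ ∈ X, z₁ ≠ z₂ ∧ dist bq.1 z₁ = 1 ∧ dist bq.1 z₂ = 1 ∧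
          (X.filter fun q => dist z₁ q = 1).card ≤ 11 ∧ (X.filter fun q => dist z₂ q = 1).card ≤ 11) ∧
      (∀ bq ∈ T, bq.1 - A w ∈ X ∧ bq.2 = bq.1 - A w ∧ ¬ IsMoving X ver A (A w) bq.1 ∧
        bq.2 - A w ∈ X ∧ IsEndMove X ver A (A w) bq.2 bq.1) := by
  -- the cell mirror
  set cM : E3 := h • EuclideanSpace.single (2 : Fin 3) (1 : ℝ) with hcM
  set M : E3 → E3 := fun q => basalMirror q + cM with hM
  set A' : E3 ≃ₗᵢ[ℝ] E3 := A.trans basalMirror with hA'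
  have hMinj : Function.Injective M := mirror_injective h
  have hMM : ∀ p, M (M p) = p := fun p => mirror_mirror h p
  have hM2 : ∀ p, M p 2 = h - p 2 := fun p => mirror_apply_two h p
  have hMlat : ∀ p, M p 0 ^ 2 + M p 1 ^ 2 = p 0 ^ 2 + p 1 ^ 2 := fun p => mirror_lat h p
  have hMdist : ∀ p q, dist (M p) (M q) = dist p q := fun p q => mirror_dist h p q
  have hcardM : ∀ (Y : Finset E3) (p : E3 → Prop) [DecidablePred p],
      ((Y.image M).filter p).card = (Y.filter fun q => p (M q)).card :=
    fun Y p _ => by rw [filter_image, card_image_of_injective _ hMinj]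
  have hmemM : ∀ b v : E3, M b + v ∈ X.image M ↔ b + basalMirror v ∈ X := fun b v => mirror_add_mem_image_iff X h b v
  have hmemX' : ∀ p, p ∈ X.image M ↔ M p ∈ X := fun p => mem_image_mirror_iff h X p
  have hX'' : (X.image M).image M = X := by
    ext p
    rw [mem_image]
    constructor
    · rintro ⟨q, hq, rfl⟩; exact (hmemX' q).1 hq
    · intro hp; exact ⟨M p, (hmemX' _).2 (by rw [hMM]; exact hp), hMM p⟩
  have hdeg : ∀ x, (X.filter fun q => dist (M x) q = 1).card = ((X.image M).filter fun q => dist x q = 1).card := by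
    intro x
    have e := mirrorCell_deg_eq X h (M x)
    rw [show basalMirror (M x) + h • EuclideanSpace.single (2 : Fin 3) (1 : ℝ) = x from hMM x] at e
    exact e.symm
  have hXsep' : ∀ p ∈ X.image M, ∀ q ∈ X.image M, p ≠ q → 1 ≤ dist p q := mirrorCell_separated X hX cM
  have hP₁'X : P₂.image M ⊆ X.image M := image_subset_image hP₂X
  have hP₂'X : P₁.image M ⊆ X.image M := image_subset_image hP₁X
  have hP₁' : ∀ p, p ∈ P₂.image M ↔ (p ∈ stacking (L₂.trans basalMirror) (M s₂) σ₂ ∧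
      -(2 * R₀) ≤ p 2 ∧ p 2 ≤ -R₀ ∧ p 0 ^ 2 + p 1 ^ 2 ≤ ρ ^ 2) := mirrorCell_plate_bottom P₂ L₂ s₂ σ₂ R₀ h ρ hP₂
  have hP₂' : ∀ p, p ∈ P₁.image M ↔ (p ∈ stacking (L₁.trans basalMirror) (M s₁) σ₁ ∧
      h + R₀ ≤ p 2 ∧ p 2 ≤ h + 2 * R₀ ∧ p 0 ^ 2 + p 1 ^ 2 ≤ ρ ^ 2) := mirrorCell_plate_top P₁ L₁ s₁ σ₁ R₀ h ρ hP₁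
  -- the launch data in the mirrored cell: frame `A ≫ bM`, the same model root, now RISING
  have hA'v : ∀ v, A' v = basalMirror (A v) := fun v => by rw [hA', LinearIsometryEquiv.trans_apply]
  have hA'2 : ∀ v, (A' v) 2 = -(A v) 2 := fun v => trans_basalMirror_apply_two A v
  have hup' : 0 < (A' w) 2 := by rw [hA'2]; linarith
  have hne₁' : (A' : E3 → E3) '' ↑fccSlots ≠ ((L₁.trans basalMirror : E3 ≃ₗᵢ[ℝ] E3) : E3 → E3) '' ↑fccSlots := by
    rw [hA', image_slots_trans_basalMirror, image_slots_trans_basalMirror]; exact image_basalMirror_ne hneA₁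
  have hne₂' : (A' : E3 → E3) '' ↑fccSlots ≠
      ((basalMirror.trans (L₁.trans basalMirror) : E3 ≃ₗᵢ[ℝ] E3) : E3 → E3) '' ↑fccSlots := by
    have e : basalMirror.trans (L₁.trans basalMirror) = (basalMirror.trans L₁).trans basalMirror :=
      LinearIsometryEquiv.ext fun x => rfl
    rw [hA', e, image_slots_trans_basalMirror, image_slots_trans_basalMirror]; exact image_basalMirror_ne hneA₂
  -- the born launch set, mirrored
  have hMsub' : ∀ p v : E3, M (p - v) = M p - basalMirror v := fun p v => by
    simp only [hM, map_sub]; abel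
  have hMsub : ∀ p v : E3, M (p - A v) = M p - A' v := fun p v => by rw [hMsub', hA'v]
  have hMadd : ∀ p v : E3, M (p + A v) = M p + A' v := fun p v => by
    simp only [hM, map_add, hA'v]; abel
  have hfullM : ∀ p, IsFull (X.image M) A' (M p) ↔ IsFull X A p := fun p =>
    isFull_transport_iff (X' := X) basalMirror cM (G := A) (b := p)
  have hreadM : ∀ (m b : E3), IsTwinReading (X.image M) A' (basalMirror m) (M b) ↔ IsTwinReading X A m b :=
    fun m b => isTwinReading_mirror_iff X h A m b
  have hnarM : ∀ (d b : E3), IsNarrow (X.image M) A' (basalMirror d) (M b) ↔ IsNarrow X A d b := fun d b =>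
    isNarrow_transport_iff (X' := X) basalMirror cM (G := A) (d := d) (b := b)
  have hmovM : ∀ (d b : E3), IsMoving (X.image M) ver A' (basalMirror d) (M b) ↔ IsMoving X ver A d b := fun d b =>
    isMoving_transport_iff (X' := X) basalMirror cM (v := ver) (G := A) (d := d) (b := b)
  have hborn' : ∀ p ∈ B.image M, p ∈ X.image M ∧ IsFull (X.image M) A' p ∧ p - A' w ∈ X.image M ∧
      ¬ (p - A' w - A' w ∈ X.image M ∧
        (IsFull (X.image M) A' (p - A' w) ∨ (∃ m, IsTwinReading (X.image M) A' m (p - A' w) ∧ ⟪A' w, m⟫_ℝ = 0) ∨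
          (ver = WordVersion.v2 ∧ IsNarrow (X.image M) A' (A' w) (p - A' w)))) := by
    intro p hp
    obtain ⟨p, hpB, rfl⟩ := mem_image.1 hp
    obtain ⟨hpX, hfull, hpred, hno⟩ := hborn p hpB
    refine ⟨mem_image_of_mem _ hpX, (hfullM p).2 hfull, by rw [← hMsub]; exact mem_image_of_mem _ hpred, ?_⟩
    rintro ⟨hpp, hmv⟩
    apply hno
    have hpp' : p - A w - A w ∈ X := by
      rw [← hMsub, ← hMsub] at hpp
      have := (hmemX' _).1 hpp
      rwa [hMM] at this
    rw [← hMsub] at hmv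
    refine ⟨hpp', ?_⟩
    rcases hmv with hf | ⟨m', htr, h0⟩ | ⟨hver, hnar⟩
    · exact Or.inl ((hfullM _).1 hf)
    · refine Or.inr (Or.inl ⟨basalMirror m', ?_, ?_⟩)
      · rw [← hreadM, basalMirror_basalMirror]; exact htr
      · rw [← LinearIsometryEquiv.inner_map_map basalMirror, basalMirror_basalMirror, ← hA'v]; exact h0
    · exact Or.inr (Or.inr ⟨hver, by rw [← hnarM, ← hA'v]; exact hnar⟩)
  -- the born census in the mirrored cell (bottom plate = mirrored top plate, top plate = mirrored bottom plate)
  obtain ⟨T', hkey', hT'pair, hT'pay, hT'move⟩ := born_barlow_endPairs ver hg hc hσ₁ (L₂.trans basalMirror) (L₁.trans basalMirror)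
    (M s₂) (M s₁) A' hne₁' hne₂' hw hup' (X.image M) (P₂.image M) (P₁.image M) R₀ h ρ hR₀ hρ hXsep' hP₁'X hP₂'X hP₁' hP₂'
    (B.image M) hborn'
  -- transport of the counted terms
  have hLHS : ((B.image M).filter fun p => -(R₀ + 1) - 1 < (p + A' w) 2 ∧ (p + A' w) 2 < h + (R₀ + 1) + 1).card =
      (B.filter fun p => -(R₀ + 1) - 1 < (p + A w) 2 ∧ (p + A w) 2 < h + (R₀ + 1) + 1).card := by
    rw [hcardM]
    refine congrArg _ (filter_congr fun p _ => ?_)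
    rw [← hMadd, hM2]
    constructor
    · rintro ⟨h1, h2⟩; exact ⟨by linarith, by linarith⟩
    · rintro ⟨h1, h2⟩; exact ⟨by linarith, by linarith⟩
  have hcut : ((X.image M).filter fun b => -(R₀ + 1) - 1 ≤ b 2 ∧ b 2 < h + (R₀ + 1) + 1 ∧
        (∃ μ, ⟪w, μ⟫_ℝ = Real.sqrt (2 / 3) ∧ IsTwinReading (X.image M) A' (A' μ) b) ∧ b - A' w ∈ X.image M).card =
      (X.filter fun b => -(R₀ + 1) - 1 < b 2 ∧ b 2 ≤ h + (R₀ + 1) + 1 ∧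
        (∃ μ, ⟪w, μ⟫_ℝ = Real.sqrt (2 / 3) ∧ IsTwinReading X A (A μ) b) ∧ b - A w ∈ X).card := by
    rw [hcardM]
    refine congrArg _ (filter_congr fun b _ => ?_)
    have hread : ∀ μ, IsTwinReading (X.image M) A' (A' μ) (M b) ↔ IsTwinReading X A (A μ) b := fun μ => by
      rw [hA'v μ]; exact hreadM (A μ) b
    have hpred : M b - A' w ∈ X.image M ↔ b - A w ∈ X := by
      rw [← hMsub, hmemX', hMM]
    simp only [hread, hpred, hM2]
    constructor
    · rintro ⟨h1, h2, h3, h4⟩; exact ⟨by linarith, by linarith, h3, h4⟩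
    · rintro ⟨h1, h2, h3, h4⟩; exact ⟨by linarith, by linarith, h3, h4⟩
  have hrimT : ((X.image M).filter fun s => h + (R₀ + 1) + 1 ≤ s 2 ∧ s 2 ≤ h + (R₀ + 1) + 1 + 1 ∧
        (ρ - 1 - 2) ^ 2 < s 0 ^ 2 + s 1 ^ 2).card =
      (X.filter fun s => -(R₀ + 1) - 1 - 1 ≤ s 2 ∧ s 2 ≤ -(R₀ + 1) - 1 ∧ (ρ - 1 - 2) ^ 2 < s 0 ^ 2 + s 1 ^ 2).card := by
    rw [hcardM]
    refine congrArg _ (filter_congr fun s _ => ?_)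
    simp only [hM2, hMlat]
    constructor
    · rintro ⟨h1, h2, h3⟩; exact ⟨by linarith, by linarith, h3⟩
    · rintro ⟨h1, h2, h3⟩; exact ⟨by linarith, by linarith, h3⟩
  have hrimB : ((X.image M).filter fun s => -(R₀ + 1) - 1 - 1 ≤ s 2 ∧ s 2 < -(R₀ + 1) - 1 ∧
        (ρ - 1 - 1) ^ 2 < s 0 ^ 2 + s 1 ^ 2).card =
      (X.filter fun s => h + (R₀ + 1) + 1 < s 2 ∧ s 2 ≤ h + (R₀ + 1) + 1 + 1 ∧ (ρ - 1 - 1) ^ 2 < s 0 ^ 2 + s 1 ^ 2).card := by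
    rw [hcardM]
    refine congrArg _ (filter_congr fun s _ => ?_)
    simp only [hM2, hMlat]
    constructor
    · rintro ⟨h1, h2, h3⟩; exact ⟨by linarith, by linarith, h3⟩
    · rintro ⟨h1, h2, h3⟩; exact ⟨by linarith, by linarith, h3⟩
  rw [hLHS, hcut, hrimT, hrimB] at hkey'
  -- pull the end pairs back to `X`
  set T : Finset (E3 × E3) := T'.image (fun bq => (M bq.1, M bq.2)) with hT
  have hPinj : Function.Injective (fun bq : E3 × E3 => (M bq.1, M bq.2)) := by
    intro a b hab
    simp only [Prod.mk.injEq] at hab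
    exact Prod.ext (hMinj hab.1) (hMinj hab.2)
  have hTcard : T.card = T'.card := card_image_of_injective _ hPinj
  have hAA : A'.trans basalMirror = A := LinearIsometryEquiv.ext fun x => by
    rw [LinearIsometryEquiv.trans_apply, hA'v, basalMirror_basalMirror]
  have hAw : basalMirror (A' w) = A w := by rw [hA'v, basalMirror_basalMirror]
  refine ⟨T, by rw [hTcard]; exact hkey', ?_, ?_, ?_⟩
  · intro bq hbq
    obtain ⟨bq', hbq', rfl⟩ := mem_image.1 hbq
    obtain ⟨h1, h2, h3, h4, h5⟩ := hT'pair bq' hbq'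
    refine ⟨(hmemX' _).1 h1, (hmemX' _).1 h2, by rw [hMdist]; exact h3, ?_, ?_⟩
    · show -(R₀ + 1) - 1 < M bq'.1 2; rw [hM2]; linarith
    · show M bq'.1 2 ≤ h + (R₀ + 1) + 1; rw [hM2]; linarith
  · intro bq hbq
    obtain ⟨bq', hbq', rfl⟩ := mem_image.1 hbq
    rcases hT'pay bq' hbq' with h11 | ⟨z₁, hz₁, z₂, hz₂, hne, hd₁, hd₂, hc₁, hc₂⟩
    · left; show (X.filter fun q => dist (M bq'.1) q = 1).card ≤ 11; rw [hdeg]; exact h11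
    · right
      refine ⟨M z₁, (hmemX' _).1 hz₁, M z₂, (hmemX' _).1 hz₂, fun h' => hne (hMinj h'), ?_, ?_, ?_, ?_⟩
      · show dist (M bq'.1) (M z₁) = 1; rw [hMdist]; exact hd₁
      · show dist (M bq'.1) (M z₂) = 1; rw [hMdist]; exact hd₂
      · rw [hdeg]; exact hc₁
      · rw [hdeg]; exact hc₂
  · intro bq hbq
    obtain ⟨bq', hbq', rfl⟩ := mem_image.1 hbq
    obtain ⟨hpred, hshape, hnm, hpp, hmove⟩ := hT'move bq' hbq'
    have e1 : M bq'.1 - A w = M (bq'.1 - A' w) := by rw [hMsub', hAw]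
    have e2 : M bq'.2 - A w = M (bq'.2 - A' w) := by rw [hMsub', hAw]
    refine ⟨?_, ?_, ?_, ?_, ?_⟩
    · show M bq'.1 - A w ∈ X
      rw [e1]; exact (hmemX' _).1 hpred
    · show M bq'.2 = M bq'.1 - A w
      rw [e1, hshape]
    · show ¬ IsMoving X ver A (A w) (M bq'.1)
      intro hmov
      apply hnm
      have := (hmovM (A w) (M bq'.1)).2 hmov
      rwa [hMM, hAw.symm, basalMirror_basalMirror] at this
    · show M bq'.2 - A w ∈ X
      rw [e2]; exact (hmemX' _).1 hpp
    · show IsEndMove X ver A (A w) (M bq'.2) (M bq'.1)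
      have hmoveX := isEndMove_transport (X' := X.image M) basalMirror cM hmove
      rw [hX'', hAA, hAw] at hmoveX
      exact hmoveX

end Summit.Ventures.Crystal3D.Theorems

end
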